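import Mathlib.NumberTheory.Padics.Complex
import Mathlib.NumberTheory.NumberField.Basic
import Mathlib.RingTheory.DedekindDomain.AdicValuation
import Literature.NumberTheory.Transcendental.BrumerPadicField
import HarnessLib

/-!
# Primes above `p` and `p`-adic embeddings of a number field: the one-way bridge
# «small at every prime above `p` ⇒ small under every `p`-adic embedding» (proofs only)

Topic `Literature/NumberTheory/NumberFields`. Pure proof file (no definitions, no named facts).

For a number field `H`, a prime `p` and a ring homomorphism `σ : H → L` into an ultrametric normed
field `L` which is a normed `ℚ_p`-algebra (`L = ℚ_p`, a finite extension, `ℚ_p^alg`, `ℂ_p`), the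
absolute value `‖σ ·‖` of `H` extends `|·|_p`, hence is (equivalent to) the `w`-adic absolute value of
SOME prime `w ∣ p` of `𝓞_H` (Neukirch, ANT II (8.1)–(8.2): the valuations of `H` above `p` are the
`w = v̄_p ∘ τ`, `τ : H → ℚ̄_p`). This file proves the half of that dictionary which needs no completion
and no identification of `w`:

* `norm_embedding_lt_one_of_forall_valuation_lt_one` — if `u ∈ H` has `w`-adic valuation `< 1`
  (i.e. `ord_w u > 0`) at EVERY prime `w` of `𝓞_H` containing `p`, then `‖σ u‖ < 1`;
* `one_lt_norm_embedding_of_forall_one_lt_valuation` — if `ord_w x < 0` at every `w ∣ p`, then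
  `‖σ x‖ > 1`; `norm_embedding_div_lt_of_forall_valuation_lt` — the relative form
  (`w(u) < w(c)` at every `w ∣ p` ⇒ `‖σ u‖ < ‖σ c‖`);
* `norm_embedding_le_one_of_mem_ringOfIntegers`, `norm_embedding_natCast_eq_one_of_not_dvd` — the
  two normalisations used (`‖σ b‖ ≤ 1` on `𝓞_H`; `‖σ D‖ = 1` for `p ∤ D`).

Proof of the first: clear denominators of `u` by an integer `m ≠ 0`, strip the `p`-part of `m`
(`D := |m|/p^e`, `p ∤ D`): `a := D·u ∈ 𝓞_H` still lies in every prime above `p` (valuation criterion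
`HeightOneSpectrum.mem_integers_of_valuation_le_one`), i.e. in the radical of `p𝓞_H`, so `aⁿ = p·b`
with `b ∈ 𝓞_H` for some `n ≥ 1` (`Ideal.exists_pow_le_of_le_radical_of_fg`); then
`‖σ a‖ⁿ = p⁻¹‖σ b‖ ≤ p⁻¹ < 1` (algebraic integers have norm `≤ 1`,
`BrumerPadic.norm_le_one_of_isIntegral'`) and `‖σ u‖ = ‖σ a‖/‖σ D‖ = ‖σ a‖ < 1`.

Used by the canonical cyclotomic `p`-adic height over `H` (`CanonicalPAdicHeightCyc.lean`, predicate
`SatisfiesLocalConditionsCyc`, stated through `HeightOneSpectrum.valuation` at the primes above `p`):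
it transports the local conditions at the `w ∣ p` to every embedding `H → ℂ_p`, where the sigma
series are summed.

References: J. Neukirch, *Algebraic Number Theory* (1999), Ch. II (8.1)–(8.2) (extensions of a
valuation of `ℚ` to a number field are the `v̄ ∘ τ`; all of them are obtained this way); Ch. I (3.3).
-/

noncomputable section

open scoped Classical
open NumberField IsDedekindDomain

namespace Literature.NumberTheory.NumberFields

section Valuation

variable {H : Type*} [Field H] [NumberField H] {p : ℕ}

/-- The valuation of `p` at a prime NOT containing `p` is `1`. [folklore] -/
private theorem valuation_natCast_prime_eq_one_of_not_mem {w : HeightOneSpectrum (𝓞 H)}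
    (hw : ((p : ℕ) : 𝓞 H) ∉ w.asIdeal) : w.valuation H (p : H) = 1 := by
  rw [show (p : H) = algebraMap (𝓞 H) H ((p : ℕ) : 𝓞 H) by rw [map_natCast]]
  exact (IsDedekindDomain.HeightOneSpectrum.valuation_eq_one_iff_notMem (K := H) w).mpr hw

/-- Natural numbers have valuation `≤ 1` at every finite place. [folklore] -/
private theorem valuation_natCast_le_one (w : HeightOneSpectrum (𝓞 H)) (m : ℕ) :
    w.valuation H (m : H) ≤ 1 := by
  rw [show (m : H) = algebraMap (𝓞 H) H ((m : ℕ) : 𝓞 H) by rw [map_natCast]]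
  exact w.valuation_le_one _

end Valuation

section Embedding

variable {H : Type*} [Field H] [NumberField H] {p : ℕ} [Fact p.Prime]
  {L : Type*} [NormedField L] [NormedAlgebra ℚ_[p] L] [IsUltrametricDist L]

include p

omit [NumberField H] in
/-- Algebraic integers of `H` have norm `≤ 1` under any ring homomorphism into an ultrametric normed
`ℚ_p`-algebra field. [cite: NeukirchANT1999, Ch. II (8.2)] -/
theorem norm_embedding_le_one_of_mem_ringOfIntegers (σ : H →+* L) (b : 𝓞 H) :
    ‖σ (algebraMap (𝓞 H) H b)‖ ≤ 1 :=
  Transcendental.BrumerPadic.norm_le_one_of_isIntegral' (p := p)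
    ((RingOfIntegers.isIntegral_coe b).map σ.toIntAlgHom)

omit [NumberField H] [IsUltrametricDist L] in
/-- `‖σ p‖ = p⁻¹`. [cite: NeukirchANT1999, Ch. II (8.2)] -/
theorem norm_embedding_natCast_prime (σ : H →+* L) : ‖σ (p : H)‖ = (p : ℝ)⁻¹ := by
  rw [map_natCast, show ((p : ℕ) : L) = algebraMap ℚ_[p] L (p : ℚ_[p]) by rw [map_natCast],
    norm_algebraMap', Padic.norm_p]

omit [NumberField H] [IsUltrametricDist L] in
/-- `‖σ D‖ = 1` for a natural number `D` prime to `p`. [cite: NeukirchANT1999, Ch. II (8.2)] -/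
theorem norm_embedding_natCast_eq_one_of_not_dvd (σ : H →+* L) {D : ℕ} (hD : ¬ p ∣ D) :
    ‖σ (D : H)‖ = 1 := by
  rw [map_natCast, show ((D : ℕ) : L) = algebraMap ℚ_[p] L (D : ℚ_[p]) by rw [map_natCast],
    norm_algebraMap', Padic.norm_natCast_eq_one_iff]
  exact (Nat.Prime.coprime_iff_not_dvd (Fact.out : p.Prime)).mpr hD

omit [NumberField H] in
/-- `p` is not a unit of `𝓞_H` (seen through any `p`-adic embedding: a unit `b` with `p·b = 1`
would give `1 = ‖σ p‖‖σ b‖ ≤ p⁻¹`). [cite: NeukirchANT1999, Ch. II (8.2)] -/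
theorem not_isUnit_natCast_prime_ringOfIntegers (σ : H →+* L) : ¬ IsUnit ((p : ℕ) : 𝓞 H) := by
  rintro ⟨u, hu⟩
  have hprime : p.Prime := Fact.out
  have h1 : σ (algebraMap (𝓞 H) H (u : 𝓞 H)) * σ (algebraMap (𝓞 H) H (↑(u⁻¹) : 𝓞 H)) = 1 := by
    rw [← map_mul, ← map_mul, Units.mul_inv, map_one, map_one]
  have h2 : ‖σ (algebraMap (𝓞 H) H (u : 𝓞 H))‖ = (p : ℝ)⁻¹ := by
    rw [hu, map_natCast, norm_embedding_natCast_prime]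
  have h3 := norm_embedding_le_one_of_mem_ringOfIntegers (p := p) σ (↑(u⁻¹) : 𝓞 H)
  have h4 : (p : ℝ)⁻¹ * ‖σ (algebraMap (𝓞 H) H (↑(u⁻¹) : 𝓞 H))‖ = 1 := by
    rw [← h2, ← norm_mul, h1, norm_one]
  have hp : (1 : ℝ) < p := by exact_mod_cast hprime.one_lt
  have h5 : (p : ℝ)⁻¹ * ‖σ (algebraMap (𝓞 H) H (↑(u⁻¹) : 𝓞 H))‖ ≤ (p : ℝ)⁻¹ * 1 :=
    mul_le_mul_of_nonneg_left h3 (inv_nonneg.mpr (by positivity))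
  rw [h4, mul_one] at h5
  exact (inv_lt_one_of_one_lt₀ hp).not_ge h5

/-- An element of `𝓞_H` lying in every prime of `𝓞_H` above `p` has a power in `p𝓞_H`:
`aⁿ = p·b` for some `n ≥ 1`, `b ∈ 𝓞_H` (the radical of `p𝓞_H` is the intersection of the primes
above `p`, and `(a)` is finitely generated). [cite: NeukirchANT1999, Ch. I (3.3)] -/
theorem exists_pow_eq_prime_mul_of_forall_mem (σ : H →+* L) {a : 𝓞 H}
    (ha : ∀ w : HeightOneSpectrum (𝓞 H), ((p : ℕ) : 𝓞 H) ∈ w.asIdeal → a ∈ w.asIdeal) :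
    ∃ n : ℕ, 0 < n ∧ ∃ b : 𝓞 H, a ^ n = ((p : ℕ) : 𝓞 H) * b := by
  set J : Ideal (𝓞 H) := Ideal.span {((p : ℕ) : 𝓞 H)} with hJ
  have hp0 : ((p : ℕ) : 𝓞 H) ≠ 0 := by exact_mod_cast (Fact.out : p.Prime).ne_zero
  -- `a ∈ radical (p)`
  have hrad : Ideal.span {a} ≤ J.radical := by
    rw [Ideal.span_singleton_le_iff_mem, Ideal.radical_eq_sInf, Ideal.mem_sInf]
    rintro P ⟨hJP, hP⟩
    have hPne : P ≠ ⊥ := fun h => by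
      rw [h, hJ, Ideal.span_singleton_le_iff_mem, Ideal.mem_bot] at hJP
      exact hp0 hJP
    have hpP : ((p : ℕ) : 𝓞 H) ∈ P := hJP (Ideal.mem_span_singleton_self _)
    exact ha ⟨P, hP, hPne⟩ hpP
  obtain ⟨n, hn⟩ := Ideal.exists_pow_le_of_le_radical_of_fg hrad (Submodule.fg_span_singleton a)
  have hn0 : n ≠ 0 := by
    rintro rfl
    rw [pow_zero, Ideal.one_eq_top, top_le_iff, hJ, Ideal.span_singleton_eq_top] at hn
    exact not_isUnit_natCast_prime_ringOfIntegers (p := p) σ hn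
  refine ⟨n, Nat.pos_of_ne_zero hn0, ?_⟩
  have hmem : a ^ n ∈ J :=
    hn (by rw [Ideal.span_singleton_pow]; exact Ideal.mem_span_singleton_self _)
  rw [hJ, Ideal.mem_span_singleton'] at hmem
  obtain ⟨b, hb⟩ := hmem
  exact ⟨b, by rw [← hb, mul_comm]⟩

/-- **Small at every prime above `p` ⇒ small under every `p`-adic embedding.** For `u ∈ H` with
`w`-adic valuation `< 1` (positive order) at every prime `w` of `𝓞_H` containing `p`, and any ring
homomorphism `σ : H → L` into an ultrametric normed `ℚ_p`-algebra field, `‖σ u‖ < 1`. (The absolute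
value `‖σ ·‖` of `H` lies above `p`, Neukirch II (8.1)–(8.2); elementary proof through
`aⁿ ∈ p𝓞_H` for `a = D·u`, see the module docstring.) [cite: NeukirchANT1999, Ch. II (8.2)] -/
theorem norm_embedding_lt_one_of_forall_valuation_lt_one (σ : H →+* L) {u : H}
    (hu : ∀ w : HeightOneSpectrum (𝓞 H), ((p : ℕ) : 𝓞 H) ∈ w.asIdeal → w.valuation H u < 1) :
    ‖σ u‖ < 1 := by
  have hprime : p.Prime := Fact.out
  -- clear denominators: `m • u` integral over `ℤ`, `m ≠ 0`
  obtain ⟨m, hm⟩ := IsIntegral.exists_multiple_integral_of_isLocalization (nonZeroDivisors ℤ)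
    (Rₘ := ℚ) u (Algebra.IsIntegral.isIntegral u)
  have hm0 : (m : ℤ) ≠ 0 := nonZeroDivisors.coe_ne_zero m
  set N : ℕ := (m : ℤ).natAbs with hN
  have hN0 : N ≠ 0 := Int.natAbs_ne_zero.mpr hm0
  -- strip the `p`-part: `N = p ^ e * D`, `p ∤ D`
  obtain ⟨e, D, hD, hND⟩ := Nat.exists_eq_pow_mul_and_not_dvd hN0 p hprime.ne_one
  -- `N • u ∈ 𝓞_H`
  have hNu : IsIntegral ℤ ((N : H) * u) := by
    have h1 : ((m : ℤ) : H) * u = (m : ℤ) • u := by rw [zsmul_eq_mul]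
    have hcast : ((N : ℕ) : ℤ) = (m : ℤ) ∨ ((N : ℕ) : ℤ) = -(m : ℤ) := by
      rw [hN]; exact Int.natAbs_eq_iff.mp rfl |>.elim (fun h => Or.inl h.symm) fun h => Or.inr (by omega)
    rcases hcast with h | h
    · have : (N : H) * u = (m : ℤ) • u := by
        rw [← h1]; congr 1; exact_mod_cast h
      rw [this]; exact hm
    · have : (N : H) * u = -((m : ℤ) • u) := by
        rw [← h1, ← neg_mul]; congr 1; exact_mod_cast h
      rw [this]; exact hm.neg
  obtain ⟨c, hc⟩ : ∃ c : 𝓞 H, algebraMap (𝓞 H) H c = (N : H) * u :=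
    (IsIntegralClosure.isIntegral_iff (A := 𝓞 H)).mp hNu
  -- `a := D • u ∈ 𝓞_H`, and `a` lies in every prime above `p` (valuation criterion)
  have hpe : (N : H) = (p : H) ^ e * (D : H) := by exact_mod_cast hND
  have hval : ∀ w : HeightOneSpectrum (𝓞 H), w.valuation H ((D : H) * u) ≤ 1 ∧
      (((p : ℕ) : 𝓞 H) ∈ w.asIdeal → w.valuation H ((D : H) * u) < 1) := by
    intro w
    by_cases hw : ((p : ℕ) : 𝓞 H) ∈ w.asIdeal
    · have hlt : w.valuation H ((D : H) * u) < 1 := by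
        rw [map_mul]
        exact (mul_le_of_le_one_left' (valuation_natCast_le_one w D)).trans_lt (hu w hw)
      exact ⟨hlt.le, fun _ => hlt⟩
    · refine ⟨?_, fun h => (hw h).elim⟩
      have hp1 : w.valuation H (p : H) = 1 := valuation_natCast_prime_eq_one_of_not_mem hw
      have hc1 : w.valuation H ((N : H) * u) ≤ 1 := by rw [← hc]; exact w.valuation_le_one c
      rw [hpe, mul_assoc, map_mul, map_pow, hp1, one_pow, one_mul] at hc1
      exact hc1
  obtain ⟨a, ha⟩ : ∃ a : 𝓞 H, algebraMap (𝓞 H) H a = (D : H) * u :=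
    HeightOneSpectrum.mem_integers_of_valuation_le_one H ((D : H) * u) fun w => (hval w).1
  have hamem : ∀ w : HeightOneSpectrum (𝓞 H), ((p : ℕ) : 𝓞 H) ∈ w.asIdeal → a ∈ w.asIdeal := by
    intro w hw
    have h := (hval w).2 hw
    rw [← ha] at h
    exact (HeightOneSpectrum.valuation_lt_one_iff_mem (K := H) w a).mp h
  obtain ⟨n, hn, b, hb⟩ := exists_pow_eq_prime_mul_of_forall_mem (p := p) σ hamem
  -- norms: `‖σ a‖ⁿ = p⁻¹ ‖σ b‖ ≤ p⁻¹ < 1`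
  have hpow : σ ((D : H) * u) ^ n = σ (p : H) * σ (algebraMap (𝓞 H) H b) := by
    rw [← ha, ← map_pow, ← map_mul, ← map_pow, hb, map_mul, map_natCast]
  have hσa : ‖σ ((D : H) * u)‖ ^ n ≤ (p : ℝ)⁻¹ := by
    rw [← norm_pow, hpow, norm_mul, norm_embedding_natCast_prime]
    calc (p : ℝ)⁻¹ * ‖σ (algebraMap (𝓞 H) H b)‖ ≤ (p : ℝ)⁻¹ * 1 :=
          mul_le_mul_of_nonneg_left (norm_embedding_le_one_of_mem_ringOfIntegers (p := p) σ b)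
            (inv_nonneg.mpr (by positivity))
      _ = (p : ℝ)⁻¹ := mul_one _
  have hlt1 : ‖σ ((D : H) * u)‖ < 1 := by
    by_contra hge
    rw [not_lt] at hge
    have h1 : (1 : ℝ) ≤ ‖σ ((D : H) * u)‖ ^ n := one_le_pow₀ hge
    have hp : (p : ℝ)⁻¹ < 1 := inv_lt_one_of_one_lt₀ (by exact_mod_cast hprime.one_lt)
    linarith
  rwa [map_mul, norm_mul, norm_embedding_natCast_eq_one_of_not_dvd (p := p) σ hD, one_mul] at hlt1

/-- **Large at every prime above `p` ⇒ large under every `p`-adic embedding**: if `x ∈ H` has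
`w`-adic valuation `> 1` (negative order, `x⁻¹ ∈ w`) at every prime `w ∋ p` of `𝓞_H`, then
`‖σ x‖ > 1`. [cite: NeukirchANT1999, Ch. II (8.2)] -/
theorem one_lt_norm_embedding_of_forall_one_lt_valuation (σ : H →+* L) {x : H}
    (hx : ∀ w : HeightOneSpectrum (𝓞 H), ((p : ℕ) : 𝓞 H) ∈ w.asIdeal → 1 < w.valuation H x) :
    1 < ‖σ x‖ := by
  by_cases hx0 : x = 0
  · -- no prime above `p`? then `p` would be a unit; but there is always one, so `hx` is absurd at `0`
    exfalso
    have hp : ¬ IsUnit ((p : ℕ) : 𝓞 H) := not_isUnit_natCast_prime_ringOfIntegers (p := p) σ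
    obtain ⟨M, hM, hpM⟩ := Ideal.exists_le_maximal (Ideal.span {((p : ℕ) : 𝓞 H)})
      (fun h => hp (Ideal.span_singleton_eq_top.mp h))
    have hMne : M ≠ ⊥ := fun h => by
      rw [h, Ideal.span_singleton_le_iff_mem, Ideal.mem_bot] at hpM
      exact (Fact.out : p.Prime).ne_zero (by exact_mod_cast hpM)
    have h := hx ⟨M, hM.isPrime, hMne⟩ (hpM (Ideal.mem_span_singleton_self _))
    rw [hx0, map_zero] at h
    exact not_lt_of_ge zero_le_one h
  have hinv : ∀ w : HeightOneSpectrum (𝓞 H), ((p : ℕ) : 𝓞 H) ∈ w.asIdeal →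
      w.valuation H x⁻¹ < 1 := fun w hw => by
    rw [map_inv₀, inv_lt_one_iff₀]
    exact Or.inr (hx w hw)
  have h := norm_embedding_lt_one_of_forall_valuation_lt_one (p := p) σ hinv
  rw [map_inv₀, norm_inv] at h
  have hσ0 : 0 < ‖σ x‖ := norm_pos_iff.mpr ((map_ne_zero σ).mpr hx0)
  exact (inv_lt_one₀ hσ0).mp h

/-- **Relative form**: if `w(u) < w(c)` at every prime `w ∋ p` (with `c ≠ 0`), then
`‖σ u‖ < ‖σ c‖` — e.g. the sigma-disc condition `w(z^{p−1}) < w(p)` gives `‖σ z‖^{p−1} < p⁻¹`.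
[cite: NeukirchANT1999, Ch. II (8.2)] -/
theorem norm_embedding_lt_of_forall_valuation_lt (σ : H →+* L) {u c : H} (hc : c ≠ 0)
    (h : ∀ w : HeightOneSpectrum (𝓞 H), ((p : ℕ) : 𝓞 H) ∈ w.asIdeal →
      w.valuation H u < w.valuation H c) :
    ‖σ u‖ < ‖σ c‖ := by
  have hq : ∀ w : HeightOneSpectrum (𝓞 H), ((p : ℕ) : 𝓞 H) ∈ w.asIdeal →
      w.valuation H (u / c) < 1 := fun w hw => by
    have hc' : w.valuation H c ≠ 0 := (Valuation.ne_zero_iff _).mpr hc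
    rw [map_div₀, div_lt_one₀ (zero_lt_iff.mpr hc')]
    exact h w hw
  have hlt := norm_embedding_lt_one_of_forall_valuation_lt_one (p := p) σ hq
  have hσc : 0 < ‖σ c‖ := norm_pos_iff.mpr ((map_ne_zero σ).mpr hc)
  rwa [map_div₀, norm_div, div_lt_one hσc] at hlt

/-- **The sigma disc at `p`, transported**: if `w(z^{p−1}) < w(p)` at every prime `w ∋ p` of `𝓞_H`
(the cyclotomic-height local condition `ord_p z > 1/(p−1)`), then `‖σ z‖^{p−1} < p⁻¹` under every
`p`-adic embedding. [cite: NeukirchANT1999, Ch. II (8.2)] -/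
theorem norm_embedding_pow_lt_of_forall_valuation_pow_lt (σ : H →+* L) {z : H}
    (h : ∀ w : HeightOneSpectrum (𝓞 H), ((p : ℕ) : 𝓞 H) ∈ w.asIdeal →
      w.valuation H (z ^ (p - 1)) < w.valuation H (p : H)) :
    ‖σ z‖ ^ (p - 1) < (p : ℝ)⁻¹ := by
  have hp0 : (p : H) ≠ 0 := by exact_mod_cast (Fact.out : p.Prime).ne_zero
  have hlt := norm_embedding_lt_of_forall_valuation_lt (p := p) σ hp0 h
  rwa [map_pow, norm_pow, norm_embedding_natCast_prime] at hlt

/-- Instance check: the bridge at `L = ℂ_p` (the field in which the cyclotomic-height series are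
summed). [cite: NeukirchANT1999, Ch. II (8.2)] -/
example (σ : H →+* ℂ_[p]) {u : H}
    (hu : ∀ w : HeightOneSpectrum (𝓞 H), ((p : ℕ) : 𝓞 H) ∈ w.asIdeal → w.valuation H u < 1) :
    ‖σ u‖ < 1 :=
  norm_embedding_lt_one_of_forall_valuation_lt_one (p := p) σ hu

end Embedding

end Literature.NumberTheory.NumberFields

end
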